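import Summits.QuantumFields.YangMills.Theses.LuscherReduction
import Summits.QuantumFields.YangMills.Theorems.LuscherReductionUpperTraceDoorDefs
import HarnessLib

/-!
# Crux-ideate #1 (round 1) on `TwistedTraceScaling` (stmt-QuantumFields-20203) — typed FIRST LEMMAS of two idea cards

Seat ym-cruxidea-20203-1 g0 (planner, count-neutral; no route decl restated or weakened; the crux
`Summit.QuantumFields.YangMills.Theses.LuscherReduction.TwistedTraceScaling` is concluded BY NAME in the composition Props).
Nothing is asserted: `def … : Prop` only (no `sorry`, no `theorem`).  HONEST FRAMING: stub-level ideation on a child of the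
CONDITIONAL reduction route `LuscherReduction` (femto rung R2b1, `FemtoGapOfRecord`); nothing here bears on infinite volume, the
continuum limit in large volume, or the Clay mass gap.

* §A  card `intrinsic-gap-clock`: the INTRINSIC CLOCK `firstGap L β = log(λ₀/λ₁)`; the canonical factorisation
  `TwistedTraceScaling ⟸ IntrinsicTraceLaw (SHAPE, label-free conclusion) ∧ FirstGapScaling (CAL, one number)` and its necessity.
* §C  card `peierls-lower-jaw`: the DIRECTION factorisation in pure trace currency `TwistedTraceScaling ⟸ UTL ∧ LTL`, with the lower
  trace law `LTD.LowerTraceLawAt` (mirror of the tree's `UTD.UpperTraceLawAt`) fed by a COARSE, LEAKAGE-FREE diagonal Ritz family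
  `LTD.CoarseLowerRitzAt` through the Peierls–Rayleigh–Ritz trace inequality `PeierlsLowerJaw`.
References: M. Lüscher, NPB 219 (1983) 233 [cite: Luscher1983, §3]; Lüscher–Münster, NPB 232 (1984) 445 [cite: LuscherMunster1984];
Reed–Simon IV, Thm XIII.1 [cite: ReedSimonIV1978, Thm. XIII.1].
-/

set_option autoImplicit false

noncomputable section

open Literature.MathematicalPhysics.QuantumFieldTheory (GaugeConfig)
open scoped BigOperators

namespace Summit.QuantumFields.YangMills.Cruxes.TwistedTraceScaling.Ideas

open Summit.QuantumFields.YangMills.Theorems.FemtoTransferGap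
open Summit.QuantumFields.YangMills.Theorems.FemtoTransferGap.TT (physTrace)
open Summit.QuantumFields.YangMills.Theorems.FemtoTransferGap.TraceDoor
open Summit.QuantumFields.YangMills.Theses.LuscherReduction (TwistedTraceScaling)

/-! ## §A  Card `intrinsic-gap-clock` -/

/-- **Intrinsic clock.**  The first zero-flux gap per transfer step, `g₁(L,β) = log(λ₀/λ₁) = E₁ − E₀` (`λ_k = levelValue su2Rep L β k`,
the min–max values with multiplicity; `λ₀ > 0` is `levelValue_zero_su2Rep_pos`).  No label, no coupling: a spectral datum of the fine
lattice itself. [cite: LuscherMunster1984] -/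
def firstGap (L : ℕ) [NeZero L] (β : ℝ) : ℝ :=
  Real.log (levelValue su2Rep L β 0 / levelValue su2Rep L β 1)

/-- **SHAPE — `IntrinsicTraceLawAt s ε`.**  Deep in the femto window, whenever the number of steps `T` spans femto-time `s` ON THE
INTRINSIC CLOCK (`|T·g₁(L,β) − s·ε₁| ≤ δ`, `ε₁ = levelGap 1`), the vacuum-free dyadic trace ratio is within `ε` of Lüscher's `r_𝔥(s)`.
The conclusion contains neither `luscherLambda` nor `oneSiteCoupling`: it is the statement that the low zero-flux spectrum IN UNITS OF ITS
OWN FIRST GAP is the spectrum of `𝔥` (dimensional reduction ∕ spectral-shape universality), uniformly in the lattice.  Implied by the crux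
(via the tree's `TraceDoor.coarseLevels_of_twistedTraceScaling` + the femto Weyl bound); does not imply it (no calibration). OPEN (XL⁻).
[cite: Luscher1983, §3] [cite: LuscherMunster1984] -/
def IntrinsicTraceLawAt (s ε : ℝ) : Prop :=
  ∃ δ : ℝ, 0 < δ ∧ ∃ lam0 : ℝ, 0 < lam0 ∧ ∀ lam : ℝ, 0 < lam → lam ≤ lam0 →
    ∃ L0 : ℕ, ∀ (L : ℕ) [NeZero L], L0 ≤ L → ∀ β : ℝ, InFemtoWindow lam β L →
      ∀ T : ℕ, |(T : ℝ) * firstGap L β - s * levelGap 1| ≤ δ → |traceRatio L β T - hTraceRatio s| ≤ ε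

/-- SHAPE, closed form. -/
def IntrinsicTraceLaw : Prop := ∀ s : ℝ, 0 < s → ∀ ε : ℝ, 0 < ε → IntrinsicTraceLawAt s ε

/-- **CAL — `FirstGapScalingAt η`.**  Deep in the femto window the first gap obeys Lüscher's law against the TWO-LOOP label to relative
precision `η`: `|L·g₁(L,β)/(ε₁·Λ(β,L)) − 1| ≤ η`, i.e. `e^{−(1+η)ε₁Λ/L} ≤ λ₁/λ₀ ≤ e^{−(1−η)ε₁Λ/L}` — the `k = 1` slice of the coarse
two-sided Lüscher law (`CoarseLevels`), hence NECESSARY for the crux (tree `coarseLevels_of_twistedTraceScaling`).  ONE observable; this is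
where the two-loop running (`b₁` in `sizeLog`) is paid observably.  Strictly weaker than `FemtoGapOfRecord` (slack `ηΛ`, not `CΛ²`). OPEN (XL).
[cite: Luscher1983, §3] [cite: LuscherWeiszWolff1991] -/
def FirstGapScalingAt (η : ℝ) : Prop :=
  ∃ lam0 : ℝ, 0 < lam0 ∧ ∀ lam : ℝ, 0 < lam → lam ≤ lam0 →
    ∃ L0 : ℕ, ∀ (L : ℕ) [NeZero L], L0 ≤ L → ∀ β : ℝ, InFemtoWindow lam β L →
      |(L : ℝ) * firstGap L β / (levelGap 1 * luscherLambda β L) - 1| ≤ η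

/-- CAL, closed form. -/
def FirstGapScaling : Prop := ∀ η : ℝ, 0 < η → FirstGapScalingAt η

/-- **First lemma of the line (composition, concludes the crux BY NAME).**  `SHAPE ∧ CAL ⟹ TwistedTraceScaling`; the one-site side is the
tree theorem `TraceDoor.oneSiteTraceLimit` (landed S-OSTL) + `femtoSteps_mul_sub_le`, so it is not a hypothesis.  Real analysis (~80 lines):
at `T = femtoSteps s β L`, CAL with `η ≤ δ/(2sε₁)` and `Λ/L ≤ δ/(4ε₁)` give `|T·g₁ − sε₁| ≤ δ`, then SHAPE and OSTL by the triangle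
inequality through `r_𝔥(s)`. -/
def ClockComposition : Prop := IntrinsicTraceLaw → FirstGapScaling → TwistedTraceScaling

/-- **Necessity (the cut is canonical).**  Both pieces follow from the crux: CAL is `CoarseLevels` at `k = 1`; SHAPE is `CoarseLevels ∀ k` +
the femto Weyl tail (`UTD.FemtoWeylAt`, itself implied by the crux with the closed child `OneSiteTail`). -/
def ClockNecessity : Prop := TwistedTraceScaling → FirstGapScaling ∧ IntrinsicTraceLaw

/-- Uniform (threshold-free in `lam`) strengthening of CAL recorded for the disprover ∕ plan seat: the femto error is a function of `Λ` alone,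
so NO `L0(lam)`; at `L = 1` it compares two one-site models (couplings `β` and `2·invRunningCoupling β 1`) and is numerically decidable. -/
def UniformFirstGapScalingAt (η : ℝ) : Prop :=
  ∃ lam0 : ℝ, 0 < lam0 ∧ ∃ L0 : ℕ, ∀ (L : ℕ) [NeZero L], L0 ≤ L → ∀ β : ℝ, 1 ≤ β →
    0 < luscherLambda β L → luscherLambda β L ≤ lam0 →
      |(L : ℝ) * firstGap L β / (levelGap 1 * luscherLambda β L) - 1| ≤ η

/-! ## §C  Card `peierls-lower-jaw` -/

/-- **LTL — `LTD.LowerTraceLawAt s ε`**, the mirror image of the tree's `UTD.UpperTraceLawAt s ε`, in the ONE-STEP-ROBUST form the ratio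
sandwich consumes (the dyadic point `2·⌈sL/Λ⌉` is NOT `⌈2sL/Λ⌉` in general, and a lower bound does not propagate to MORE steps by monotonicity —
an upper one does): deep in the femto window, for every step count `T` within two steps of femto-time `s` (`|T·Λ/L − s| ≤ 2Λ/L`, so both
`⌈sL/Λ⌉` and `2⌈(s/2)L/Λ⌉` qualify) and `B = 2L³/Λ³`, `(Z_phys(1,B,T)/μ₀^T − ε)·λ₀^T ≤ Z_phys(L,β,T)` — "no MISSING low-lying zero-flux spectral
weight relative to the one-site tower".  ONE-SIDED; implied by the crux (via `CoarseLevels` ∀k + closed `OneSiteTail`), and `UTL ∧ LTL ⟹ crux`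
(`DirectionComposition`).  OPEN (L given coarse lower Ritz data: `LowerFromRitz`). [cite: Luscher1983, §3] -/
def LTD.LowerTraceLawAt (s ε : ℝ) : Prop :=
  ∃ lam0 : ℝ, 0 < lam0 ∧ ∀ lam : ℝ, 0 < lam → lam ≤ lam0 →
    ∃ L0 : ℕ, ∀ (L : ℕ) [NeZero L], L0 ≤ L → ∀ β : ℝ, InFemtoWindow lam β L →
      ∀ T : ℕ, |(T : ℝ) * luscherLambda β L / L - s| ≤ 2 * luscherLambda β L / L →
        (physTrace 1 (oneSiteCoupling β L) T / levelValue su2Rep 1 (oneSiteCoupling β L) 0 ^ T - ε) *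
            levelValue su2Rep L β 0 ^ T ≤ physTrace L β T

/-- **Coarse, leakage-free lower Ritz data — `LTD.CoarseLowerRitzAt k η`.**  Eventually in the femto window there is a PHYSICAL,
`l2`-orthonormal, `qform`-diagonal family `φ₀ … φ_k` with non-increasing Ritz values `m_i = ⟨φ_i, K_β φ_i⟩` such that (i⁻) the Ritz RATIOS
sit ABOVE the one-site ratios up to `e^{−ηΛ/L}`: `e^{−ηΛ/L}·μ_j·m₀ ≤ m_j·μ₀` (one-sided, COARSE: slack `ηΛ`, not `CΛ²`), and (iii) coarse
top capture `⟨ψ,K_βψ⟩ ≤ e^{ηΛ/L} m₀‖ψ‖²`.  Compared with the sibling route item `DressedRitz` (stmt-20205): NO residual-Gram ∕ leakage clause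
(ii′), NO upper side of (i), NO sharp constant — exactly what the trace lower jaw consumes (by `UTD.lowerJaw`-type Rayleigh–Ritz ≤ min–max,
no near-invariance needed); `DressedRitz` implies it a fortiori. OPEN (L–XL: the vacuum-dressed Dirichlet form of `k+1` zero-mode test
functions, two-loop calibrated). [cite: Luscher1983, §3] [cite: ReedSimonIV1978, Thm. XIII.1] -/
def LTD.CoarseLowerRitzAt (k : ℕ) (η : ℝ) : Prop :=
  ∃ lam0 : ℝ, 0 < lam0 ∧ ∀ lam : ℝ, 0 < lam → lam ≤ lam0 →
    ∃ L0 : ℕ, ∀ (L : ℕ) [NeZero L], L0 ≤ L → ∀ β : ℝ, InFemtoWindow lam β L →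
      ∃ φ : Fin (k + 1) → (GaugeConfig 3 L SU2 → ℝ),
        (∀ i, IsPhys (φ i)) ∧ (∀ i l, l2 (φ i) (φ l) = if i = l then 1 else 0) ∧
        (∀ i l, i ≠ l → qform su2Rep β (φ i) (φ l) = 0) ∧
        (∀ i l : Fin (k + 1), i ≤ l → qform su2Rep β (φ l) (φ l) ≤ qform su2Rep β (φ i) (φ i)) ∧
        (∀ j : Fin (k + 1),
          Real.exp (-(η * luscherLambda β L / L)) *
              (levelValue su2Rep 1 (oneSiteCoupling β L) j * qform su2Rep β (φ 0) (φ 0)) ≤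
            qform su2Rep β (φ j) (φ j) * levelValue su2Rep 1 (oneSiteCoupling β L) 0) ∧
        (∀ ψ : GaugeConfig 3 L SU2 → ℝ, IsPhys ψ →
          qform su2Rep β ψ ψ ≤ Real.exp (η * luscherLambda β L / L) * qform su2Rep β (φ 0) (φ 0) * l2 ψ ψ)

/-- **First lemma of the line — the Peierls ∕ Rayleigh–Ritz trace lower jaw (fixed lattice, no window, M-sized, provable now).**  For
`β ≥ 1`, `T ≥ 2` and any physical `l2`-orthonormal `qform`-diagonal family with non-increasing Ritz values, `Σ_i m_i^T ≤ Z_phys(L,β,T)`: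
Rayleigh–Ritz `m_j ≤ λ_j` (tree `KTDoorR3.ritzBasicsR3`) termwise, then `Σ_{j≤k} λ_j^T ≤ Σ_j λ_j^T = Z_phys(T)` (closed child `TraceFormula`,
`UTD.hasSum_xval_pow`, nonnegativity `UTD.xval_nonneg`, `FemtoTransferGapPositivity.levelValue_nonneg_of_qform_nonneg`).  (For a NON-diagonal family Jensen on the spectral measure,
`⟨φ,K^Tφ⟩ ≥ ⟨φ,Kφ⟩^T`, gives the same — Peierls' inequality; not needed after a Ritz rotation `exists_orthonormal_formDiagonal_antitone`.) -/
def PeierlsLowerJaw : Prop :=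
  ∀ (L : ℕ) [NeZero L] (β : ℝ) (T n : ℕ) (φ : Fin n → (GaugeConfig 3 L SU2 → ℝ)), 1 ≤ β → 2 ≤ T →
    (∀ i, IsPhys (φ i)) → (∀ i l, l2 (φ i) (φ l) = if i = l then 1 else 0) →
    (∀ i l, i ≠ l → qform su2Rep β (φ i) (φ l) = 0) →
    (∀ i l : Fin n, i ≤ l → qform su2Rep β (φ l) (φ l) ≤ qform su2Rep β (φ i) (φ i)) →
      ∑ i : Fin n, qform su2Rep β (φ i) (φ i) ^ T ≤ physTrace L β T

/-- Lower trace law from coarse lower Ritz data (+ the closed one-site tail to choose `k = K(s,ε)`): `PeierlsLowerJaw`, top capture, and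
`Σ_{j>K}(μ_j/μ₀)^T ≤ ε/2` (`OneSiteTail`, closed). -/
def LowerFromRitz : Prop :=
  (∀ k : ℕ, ∀ η : ℝ, 0 < η → LTD.CoarseLowerRitzAt k η) → ∀ s : ℝ, 0 < s → ∀ ε : ℝ, 0 < ε → LTD.LowerTraceLawAt s ε

/-- **Composition (concludes the crux BY NAME).**  `UTL ∧ LTL ⟹ TwistedTraceScaling`: with `T = ⌈sL/Λ⌉`, `𝔷_L(n) = Z_phys(L,β,n)/λ₀^n`
(non-increasing in `n`: `UTD.xval_nonneg`, `UTD.xval_le_one`) and `𝔷_1(n) = Z_phys(1,B,n)/μ₀^n ≥ 1`: UPPER at `T` directly and at `2T` through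
`𝔷_L(2T) ≤ 𝔷_L(⌈2sL/Λ⌉)` (`UTD.two_mul_femtoSteps_le`) + UTL at femto-time `2s` + the explicit one-site step `𝔷_1(⌈2sL/Λ⌉) ≤ 𝔷_1(2T) + o(1)`
(`UTD.pow_le_pow_add_one_sub`, closed `OneSiteTail`); LOWER at `T` and `2T` directly from the robust LTL at femto-times `s` and `2s`; then
`UTD.ratio_rule` (`|b/a² − b₁/a₁²| ≤ |b−b₁| + 2|a−a₁|` for `1 ≤ a, a₁`, `b ≤ a`, `b₁ ≤ a₁`).  Pure real analysis, ~150 lines. -/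
def DirectionComposition : Prop :=
  (∀ s : ℝ, 0 < s → ∀ ε : ℝ, 0 < ε → UTD.UpperTraceLawAt s ε) →
    (∀ s : ℝ, 0 < s → ∀ ε : ℝ, 0 < ε → LTD.LowerTraceLawAt s ε) → TwistedTraceScaling

end Summit.QuantumFields.YangMills.Cruxes.TwistedTraceScaling.Ideas

end
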